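import Mathlib

/-!
# Spectral-versus-Frobenius gap of a polynomial eigenvalue map, the Hölder-pairing witness, and the
# read-out budget of a block-encoded matrix (DEQ-A82)

HONEST FRAMING: instance-level adjudication of specific advantage claims; no claim about
BQP vs BPP or the summit.

Context (cell pub-qadeq, claim A-82 = Nie, An, Wen, "Quantum Alternating Direction Method of Multipliers
for Semidefinite Programming", arXiv:2510.10056v4 = Quantum 10, 2154 (2026): Lemma D.1, (E.4), the error
terms `e⁽¹⁾, e⁽²⁾` on p. 26, (E.11), Proposition 2.3 and §4.2 item 3).  DEQ-A82.md (unit pub-qadeq-deq-1)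
records three corrections to the paper's cost accounting; this file proves, sorry-free, the finite
identities and inequalities that carry them.  Matrix functional calculus is not formalised: for a real
symmetric `V = Q diag(λ) Qᵀ` and a scalar map `g`, `‖g(V) − V₊‖_F² = Σᵢ (g(λᵢ) − λᵢ⁺)²` and
`‖g(V) − V₊‖₂ = maxᵢ |g(λᵢ) − λᵢ⁺|` by unitary invariance, so every statement below is phrased on the
vector `e i = g(λᵢ) − λᵢ⁺` of eigenvalue errors (index type `ι`, `n = Fintype.card ι`).

* `sum_sq_le_card_mul_sq`, `sqrt_sum_sq_le`: a uniform (spectral-norm) guarantee `|e i| ≤ δ` gives only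
  `‖e‖₂ ≤ √n · δ` in the Euclidean (Frobenius) norm — Lemma F of DEQ-A82: the paper's Lemma D.1 / (E.4)
  deliver the spectral bound while `e⁽¹⁾`, `e⁽²⁾`, (E.11) consume the Frobenius one;
* `sum_sq_of_const`, `sqrt_sum_sq_of_const`: the bound is attained when all eigenvalues sit at a point of
  maximal scalar error (`V = x⋆·I`), so a worst-case Frobenius guarantee `δ` forces the scalar sup-error
  down to `δ/√n`, i.e. polynomial degree `Θ(√n·B/δ)` instead of `Θ(B/δ)` (Bernstein: `E_d(|x|) ~ 0.2802/d`);
* `pairing_witness_sum`, `pairing_witness_norm_sq`: with `e i = δ` and `x i = R/√n` one has `Σ x² = R²`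
  but `Σ e·x = √n·δ·R` — the inner products `⟨ΔX̃, X̂ − Xᵏ⟩`, `⟨ΔS̃, X̂ − A*(ŷ − y)⟩` of p. 26 cannot be
  bounded by (spectral bound) × (Frobenius radius) without the factor `√n`;
* `choi_amplitude_sq`, `sum_choi_amplitude_sq`, `column_budget_sq`, `column_query_sum`: the amplitudes of
  the Choi state of a block-encoded `P` are `P i j/√n` (total weight `‖P‖_F²/n`), and splitting a Frobenius
  budget `ε` over `n` column states gives `ε/√n` per column, so the linear-in-dimension tomography primitive
  the paper invokes (Prop. 2.3: `Θ̃(dim/accuracy)` queries to a state-PREPARATION unitary) costs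
  `Σⱼ n/(ε/√n) = n²√n/ε` block-encoding uses, not `n²·R_S/δ_S`;
* `corrected_update_product`, `corrected_update_ge`: corrected degree `c·√n·r` times corrected read-out
  `n²·√n·(2r)` (`r = e_V/δ ≥ 1`) is `2c·n³·r² ≥ 2c·n³` — at least the classical dense projection cost;
* `direct_setup_dominated`: the one-time `n⁶` of direct-factorisation ADMM is dominated by the `n⁴·K`
  iteration work as soon as `K ≥ n²` (the accounting remark (γ) of DEQ-A82).

Everything is `[folklore]`-level finite algebra / real arithmetic; no named fact, no axiom, no `def`.
-/

namespace Literature.Computability.QuantumAlgorithms.SpectralFrobeniusGap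

open Finset BigOperators

section SpectralVsFrobenius

variable {ι : Type*} [Fintype ι]

/-- `[folklore]` **Lemma F (upper bound).** If every eigenvalue error satisfies `|e i| ≤ δ`
(a spectral-norm guarantee), then `Σ (e i)² ≤ n·δ²` (Frobenius norm squared ≤ `n`·spectral²). -/
theorem sum_sq_le_card_mul_sq (e : ι → ℝ) (δ : ℝ) (h : ∀ i, |e i| ≤ δ) :
    ∑ i, (e i) ^ 2 ≤ (Fintype.card ι : ℝ) * δ ^ 2 := by
  have hterm : ∀ i ∈ (univ : Finset ι), (e i) ^ 2 ≤ δ ^ 2 := by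
    intro i _
    have hi := h i
    exact sq_le_sq.mpr (hi.trans (le_abs_self δ))
  calc ∑ i, (e i) ^ 2 ≤ ∑ _i : ι, δ ^ 2 := Finset.sum_le_sum hterm
    _ = (Fintype.card ι : ℝ) * δ ^ 2 := by simp [Finset.sum_const, Finset.card_univ]

/-- `[folklore]` **Lemma F (norm form).** `|e i| ≤ δ` for all `i` and `0 ≤ δ` give
`√(Σ (e i)²) ≤ √n · δ`. -/
theorem sqrt_sum_sq_le (e : ι → ℝ) (δ : ℝ) (hδ : 0 ≤ δ) (h : ∀ i, |e i| ≤ δ) :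
    Real.sqrt (∑ i, (e i) ^ 2) ≤ Real.sqrt (Fintype.card ι : ℝ) * δ := by
  have h1 := sum_sq_le_card_mul_sq e δ h
  calc Real.sqrt (∑ i, (e i) ^ 2) ≤ Real.sqrt ((Fintype.card ι : ℝ) * δ ^ 2) :=
        Real.sqrt_le_sqrt h1
    _ = Real.sqrt (Fintype.card ι : ℝ) * δ := by
        rw [Real.sqrt_mul (Nat.cast_nonneg _), Real.sqrt_sq hδ]

/-- `[folklore]` **Lemma F is tight.** If all eigenvalues sit at a point of maximal scalar error
(`V = x⋆·I`), i.e. `e i = δ` for all `i`, then `Σ (e i)² = n·δ²`. -/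
theorem sum_sq_of_const (e : ι → ℝ) (δ : ℝ) (h : ∀ i, e i = δ) :
    ∑ i, (e i) ^ 2 = (Fintype.card ι : ℝ) * δ ^ 2 := by
  simp [h, Finset.sum_const, Finset.card_univ]

/-- `[folklore]` Norm form of the tightness witness: `√(Σ (e i)²) = √n · |δ|` when `e i = δ`. -/
theorem sqrt_sum_sq_of_const (e : ι → ℝ) (δ : ℝ) (h : ∀ i, e i = δ) :
    Real.sqrt (∑ i, (e i) ^ 2) = Real.sqrt (Fintype.card ι : ℝ) * |δ| := by
  rw [sum_sq_of_const e δ h, Real.sqrt_mul (Nat.cast_nonneg _), Real.sqrt_sq_eq_abs]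

end SpectralVsFrobenius

section Pairing

/-- `[folklore]` **Hölder-pairing witness, norm side.** For `0 < n`, the vector `x i = R/√n`
(`i : Fin n`) has `Σ (x i)² = R²` (Frobenius radius `|R|`). -/
theorem pairing_witness_norm_sq (n : ℕ) (hn : 0 < n) (R : ℝ) :
    ∑ _i : Fin n, (R / Real.sqrt n) ^ 2 = R ^ 2 := by
  have hn' : (0 : ℝ) < n := by exact_mod_cast hn
  have hs : Real.sqrt (n : ℝ) ^ 2 = n := Real.sq_sqrt hn'.le
  rw [Finset.sum_const, Finset.card_univ, Fintype.card_fin, nsmul_eq_mul, div_pow, hs]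
  field_simp

/-- `[folklore]` **Hölder-pairing witness, pairing side.** With `e i = δ` (spectral bound `δ`) and
`x i = R/√n` (Frobenius norm `|R|`), `Σ e i · x i = √n · (δ·R)`: bounding `⟨Δ, X⟩` by
`‖Δ‖₂ · ‖X‖_F` is off by exactly `√n` (the correct dual of the spectral norm is the nuclear norm). -/
theorem pairing_witness_sum (n : ℕ) (hn : 0 < n) (δ R : ℝ) :
    ∑ _i : Fin n, δ * (R / Real.sqrt n) = Real.sqrt n * (δ * R) := by
  have hn' : (0 : ℝ) < n := by exact_mod_cast hn
  have hsq : Real.sqrt (n : ℝ) * Real.sqrt n = n := Real.mul_self_sqrt hn'.le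
  have hpos : 0 < Real.sqrt (n : ℝ) := Real.sqrt_pos.mpr hn'
  rw [Finset.sum_const, Finset.card_univ, Fintype.card_fin, nsmul_eq_mul]
  calc (n : ℝ) * (δ * (R / Real.sqrt n))
        = (Real.sqrt n * Real.sqrt n) * (δ * (R / Real.sqrt n)) := by rw [hsq]
    _ = Real.sqrt n * (δ * R) * (Real.sqrt n / Real.sqrt n) := by ring
    _ = Real.sqrt n * (δ * R) := by rw [div_self hpos.ne', mul_one]

end Pairing

section ReadOut

/-- `[folklore]` Choi-state amplitude of a block-encoded matrix entry: `(P i j/√n)² = (P i j)²/n`. -/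
theorem choi_amplitude_sq (n : ℕ) (p : ℝ) : (p / Real.sqrt n) ^ 2 = p ^ 2 / n := by
  rw [div_pow, Real.sq_sqrt (Nat.cast_nonneg n)]

/-- `[folklore]` **Choi-state weight.** Applying a block-encoding of `P` to half of the maximally
entangled state `(1/√n) Σⱼ |j⟩|j⟩` puts amplitude `P i j/√n` on the flagged basis state `|i⟩|j⟩`; the
total flagged weight is `‖P‖_F²/n` (so amplitude accuracy `ε/√n` is needed for Frobenius accuracy `ε`). -/
theorem sum_choi_amplitude_sq {ι : Type*} [Fintype ι] (P : ι → ι → ℝ) :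
    ∑ i, ∑ j, (P i j / Real.sqrt (Fintype.card ι)) ^ 2
      = (∑ i, ∑ j, (P i j) ^ 2) / (Fintype.card ι : ℝ) := by
  simp_rw [choi_amplitude_sq, Finset.sum_div]

/-- `[folklore]` **Column budget.** Splitting a Frobenius accuracy `ε` equally over the `n` column
states `U_P |0⟩|j⟩` (whose flagged amplitudes are the entries `P i j`) means `ε/√n` per column:
`Σⱼ (ε/√n)² = ε²` (`0 < n`). -/
theorem column_budget_sq (n : ℕ) (hn : 0 < n) (ε : ℝ) :
    ∑ _j : Fin n, (ε / Real.sqrt n) ^ 2 = ε ^ 2 :=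
  pairing_witness_norm_sq n hn ε

/-- `[folklore]` **Column-wise read-out count.** With the linear-in-dimension tomography primitive
(`dim/accuracy` queries per state, Prop. 2.3 of the paper), `n` columns of dimension `n` at accuracy
`ε/√n` each cost `Σⱼ n/(ε/√n) = n·n·√n/ε` block-encoding uses (`n^{2.5}/ε`, not `n²/ε`). -/
theorem column_query_sum (n : ℕ) (ε : ℝ) :
    ∑ _j : Fin n, (n : ℝ) / (ε / Real.sqrt n) = (n : ℝ) * n * Real.sqrt n / ε := by
  rw [Finset.sum_const, Finset.card_univ, Fintype.card_fin, nsmul_eq_mul, div_div_eq_mul_div]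
  ring

end ReadOut

section Accounting

/-- `[folklore]` **Corrected S-update product.** Corrected polynomial degree `c·√n·r` (Frobenius
guarantee, `r = e_V/δ`) times corrected read-out count `n²·√n·(2r)` equals `2c·n³·r²`. -/
theorem corrected_update_product (n c r : ℝ) (hn : 0 ≤ n) :
    (c * Real.sqrt n * r) * (n ^ 2 * Real.sqrt n * (2 * r)) = 2 * c * n ^ 3 * r ^ 2 := by
  have hsq : Real.sqrt n * Real.sqrt n = n := Real.mul_self_sqrt hn
  calc (c * Real.sqrt n * r) * (n ^ 2 * Real.sqrt n * (2 * r))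
        = 2 * c * n ^ 2 * (Real.sqrt n * Real.sqrt n) * r ^ 2 := by ring
    _ = 2 * c * n ^ 3 * r ^ 2 := by rw [hsq]; ring

/-- `[folklore]` **Corrected S-update is at least cubic.** For `r ≥ 1` (polynomial degree at least one,
i.e. `e_V ≥ δ`), `0 ≤ c`, `0 ≤ n`: `2c·n³ ≤ (c·√n·r)·(n²·√n·2r)` — the corrected quantum S-update cost per
iteration is at least `2c·n³`, the order of a classical dense eigendecomposition. -/
theorem corrected_update_ge (n c r : ℝ) (hn : 0 ≤ n) (hc : 0 ≤ c) (hr : 1 ≤ r) :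
    2 * c * n ^ 3 ≤ (c * Real.sqrt n * r) * (n ^ 2 * Real.sqrt n * (2 * r)) := by
  rw [corrected_update_product n c r hn]
  have h3 : 0 ≤ 2 * c * n ^ 3 := by positivity
  have hr2 : 1 ≤ r ^ 2 := by nlinarith
  nlinarith

/-- `[folklore]` **Setup amortisation (accounting remark (γ)).** If the iteration count satisfies
`n² ≤ K` then the one-time direct-factorisation cost `n⁶` is dominated by the `n⁴·K` iteration work. -/
theorem direct_setup_dominated (n K : ℝ) (hK : n ^ 2 ≤ K) : n ^ 6 ≤ n ^ 4 * K := by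
  have h4 : 0 ≤ n ^ 4 := by positivity
  calc n ^ 6 = n ^ 4 * n ^ 2 := by ring
    _ ≤ n ^ 4 * K := mul_le_mul_of_nonneg_left hK h4

end Accounting

end Literature.Computability.QuantumAlgorithms.SpectralFrobeniusGap
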